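import Literature.NumberTheory.GaloisRepresentations.IdeleProjectionHomExt
import Literature.NumberTheory.GaloisRepresentations.IdeleReadoutUnramifiedValues
import Literature.NumberTheory.GaloisRepresentations.HomDualUnitCorrection
import HarnessLib

/-!
# Extension of `J̄`-valued morphisms along `ι : X₁ ⟶ X₂` is a LOCAL property: if `π_v ∘ g` extends
# `Γ_{K_v}`-equivariantly to `X₂` at every place `v`, then `g : X₁ ⟶ J̄` extends to `X₂ ⟶ J̄` in `C_Γ`
# (idèle-torus Hasse principle for lattices; Milne *ADT* I Lemma 4.13 (proof), Tate C–F VII §8–§9)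

Topic `NumberTheory/GaloisRepresentations`; namespace `Literature.NumberTheory.GaloisRepresentations.IdeleReadout`.
Theorems only (no definition, no named fact, no instance, no notation, no `sorry`); number fields in `Type`.
Assembles this seat's `IdeleProjectionHomExt` (uniqueness of `X ⟶ J̄` from its readouts),
`IdeleReadoutUnramifiedValues` (readouts unit-valued off a finite set; integral valuations at unramified places)
and `HomDualUnitCorrection` (unit-valued correction of a local extension) with door-c5 g17's idèle ASSEMBLY
`exists_hom_readoutInvariant_eq` (`IdeleProjectionAssembly`).

THE MATHEMATICS.  `K` a number field, `E/K` a finite Galois layer, `X₁ →ι X₂` a morphism of door-c4's category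
`C_Γ = DiscreteRepCat ℤ Γ_K` between objects of finite type on which `U_E = Gal(K̄/E)` acts trivially (e.g. the
relation lattice `N₁` of the canonical presentation of a finite Galois module and a permutation cover of it), and
`g : X₁ ⟶ J̄ = lim→ J_E` (door-c5 g16 `ideleBarD K`).  Suppose that at EVERY place `v` of `K` the local readout
`π_v ∘ g : X₁ → K̄_vˣ` (door-c6/door-c5 `readoutMap (ideleProjection K v)`) extends along `ι` to a `Γ_{K_v}`-equivariant
homomorphism `e_v : X₂ → K̄_vˣ`.  THEN `g = ι ≫ f` for a `C_Γ`-morphism `f : X₂ ⟶ J̄`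
(**`exists_comp_eq_of_localExtensions`**).  Proof: `π_v ∘ g` is unit-valued off a finite `T₀`
(`exists_finset_forall_ordQ_readoutMap_eq_zero`) and `X₂` is unramified off a finite `T₁`
(`exists_finset_forall_isUnramifiedAt_toDGM`); at `v ∉ T₀ ∪ T₁` the values of `e_v` lie in `K_v^{nr}` (integral
valuation, `exists_int_cast_eq_ordQ_of_isUnramifiedAt`), so `e_v` may be replaced by the unit-valued
`e_v · ϖ_v^{-ord ∘ e_v}`, which still extends `π_v ∘ g` (`HomDual.exists_unitValued_extension`); the corrected family is
assembled into `f : X₂ ⟶ J̄` with `π_v ∘ f = e_v` (door-c5 g17), and `ι ≫ f = g` because both have the readouts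
`π_v ∘ g` at every place (`hom_ext_of_readoutInvariant_eq`).

USE (PT2 = `poitouTate_sha_tateDual`, property (e) `Ш²(K, M^D) ⊆ Im Ψ` of the `Ш²`-readout road of cell bsd-wall,
`PoitouTateShaTwoReadout.poitouTate_sha_tateDual_of_shaTwoObstruction`): with `X₂ = P₁` a permutation cover of the
relation lattice `X₁ = N₁`, a class `y ∈ Ext¹_{C_Γ}(N₁, F̄ˣ) = H¹(K, T_{N₁})` is the boundary of some `u₀ : X₁' ⟶ F̄ˣ`
on the relation module of the cover; its LOCAL triviality says that `ι_v ∘ u₀ = π_v ∘ (u₀ ≫ (F̄ˣ → J̄))` extends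
locally (`HomDual.dualδ₀_eq_zero_iff`), and this theorem then makes `u₀ ≫ (F̄ˣ → J̄)` extend globally, i.e.
`y ∘ [F̄ˣ → J̄] = 0` in `Ext¹(N₁, J̄)` — the input "(B)" that, together with the Brauer–Hasse–Noether input "(A)", gives
(e) by the degree-two chase of `ExtPresentationObstruction`.
HONEST FRAMING: no case of Poitou–Tate or BSD is proved here.

## References
* J. S. Milne, *Arithmetic Duality Theorems* (2nd ed. 2006), I Lemma 4.13 (proof) and proof of Thm. 4.10 (p. 58).
  [MilneADT2006]
* J. W. S. Cassels, A. Fröhlich (eds.), *Algebraic Number Theory* (1967), Ch. VII (Tate) §7.3, §8 Prop. 8.1, §9.7.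
  [CasselsFrohlichANT1967]
-/

noncomputable section

open NumberField NumberField.InfinitePlace IsDedekindDomain Field CategoryTheory
open Literature.NumberTheory.Automorphic

namespace Literature.NumberTheory.GaloisRepresentations

namespace IdeleReadout

open SemiLocal ArchHerbrand DiscreteGaloisModule IdeleCohomology IdeleClassBar HomDual DGMBridge
  IsNonarchimedeanLocalField Literature.Algebra.Homology Literature.Algebra.Homology.DiscreteRep

variable {K : Type} [Field K] [NumberField K] (E : GalLayer K)
variable {X₁ X₂ : DiscreteRepCat ℤ (absoluteGaloisGroup K)} (ι : X₁ ⟶ X₂)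
  (h₁ : ∀ σ ∈ E.openNormalSubgroup, ∀ x : X₁.obj.V, X₁.obj.ρ σ x = x)
  (h₂ : ∀ σ ∈ E.openNormalSubgroup, ∀ x : X₂.obj.V, X₂.obj.ρ σ x = x)
  [Module.Finite ℤ (LCarrier X₁)] [Module.Finite ℤ (LCarrier X₂)]

/-! ## §1 Correcting the local extensions at the unramified places -/

include h₁ h₂ in
/-- **The finite-place extensions can be chosen unit-valued off a finite set.**  Given, at every finite place `w`, a
`Γ_{K_w}`-equivariant `e_w : X₂ → K̄_wˣ` extending `π_w ∘ g` along `ι`, there are such extensions which moreover are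
unit-valued (`ord ∘ e_w = 0`) at every `w` outside a finite set `T`. [cite: MilneADT2006, I Lemma 4.13 (proof)] -/
theorem exists_unitValued_localExtensions (g : X₁ ⟶ ideleBarD K)
    (hfin : ∀ w : HeightOneSpectrum (𝓞 K),
      ∃ e : (homGaloisModule ((toDGM X₂).restrictField (w.adicCompletion K)) (units (w.adicCompletion K))).toTopRep.ρ.invariants,
        ∀ x : LCarrier X₁, (show LCarrier X₂ →ₗ[ℤ] UnitsCarrier (w.adicCompletion K) from
          (e.1 : DiscreteRep.HomCarrier (LCarrier X₂) (UnitsCarrier (w.adicCompletion K)))) (lmap X₁ X₂ ι x) =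
            readoutMap (ideleProjection K (Sum.inr w)) X₁ g x) :
    ∃ (T : Finset (HeightOneSpectrum (𝓞 K)))
      (e : ∀ w : HeightOneSpectrum (𝓞 K),
        (homGaloisModule ((toDGM X₂).restrictField (w.adicCompletion K)) (units (w.adicCompletion K))).toTopRep.ρ.invariants),
      (∀ (w : HeightOneSpectrum (𝓞 K)) (x : LCarrier X₁),
        (show LCarrier X₂ →ₗ[ℤ] UnitsCarrier (w.adicCompletion K) from
          ((e w).1 : DiscreteRep.HomCarrier (LCarrier X₂) (UnitsCarrier (w.adicCompletion K)))) (lmap X₁ X₂ ι x) =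
            readoutMap (ideleProjection K (Sum.inr w)) X₁ g x) ∧
      ∀ w : HeightOneSpectrum (𝓞 K), w ∉ T → ∀ p : LCarrier X₂,
        ordQ (w.adicCompletion K) ((show LCarrier X₂ →ₗ[ℤ] UnitsCarrier (w.adicCompletion K) from
          ((e w).1 : DiscreteRep.HomCarrier (LCarrier X₂) (UnitsCarrier (w.adicCompletion K)))) p) = 0 := by
  classical
  obtain ⟨T₀, hT₀⟩ := exists_finset_forall_ordQ_readoutMap_eq_zero E h₁ g
  obtain ⟨T₁, hT₁⟩ := exists_finset_forall_isUnramifiedAt_toDGM E X₂ h₂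
  have hcorr : ∀ w : HeightOneSpectrum (𝓞 K),
      ∃ e : (homGaloisModule ((toDGM X₂).restrictField (w.adicCompletion K)) (units (w.adicCompletion K))).toTopRep.ρ.invariants,
        (∀ x : LCarrier X₁, (show LCarrier X₂ →ₗ[ℤ] UnitsCarrier (w.adicCompletion K) from
          (e.1 : DiscreteRep.HomCarrier (LCarrier X₂) (UnitsCarrier (w.adicCompletion K)))) (lmap X₁ X₂ ι x) =
            readoutMap (ideleProjection K (Sum.inr w)) X₁ g x) ∧
        (w ∉ T₀ ∪ T₁ → ∀ p : LCarrier X₂,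
          ordQ (w.adicCompletion K) ((show LCarrier X₂ →ₗ[ℤ] UnitsCarrier (w.adicCompletion K) from
            (e.1 : DiscreteRep.HomCarrier (LCarrier X₂) (UnitsCarrier (w.adicCompletion K)))) p) = 0) := by
    intro w
    obtain ⟨e, he⟩ := hfin w
    by_cases hw : w ∈ T₀ ∪ T₁
    · exact ⟨e, he, fun h => (h hw).elim⟩
    · -- at an unramified place off `T₀`, correct `e` to a unit-valued extension
      have hw₀ : w ∉ T₀ := fun h => hw (Finset.mem_union_left _ h)
      have hunr : GaloisRep.IsUnramifiedAt w (toDGM X₂) := hT₁ w fun h => hw (Finset.mem_union_right _ h)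
      have hequiv := (mem_invariants_iff ((toDGM X₂).restrictField (w.adicCompletion K)) (units (w.adicCompletion K))
        e.1).1 e.2
      have hunit : ∀ x : LCarrier X₁, ordQ (w.adicCompletion K)
          ((show LCarrier X₂ →ₗ[ℤ] UnitsCarrier (w.adicCompletion K) from
            (e.1 : DiscreteRep.HomCarrier (LCarrier X₂) (UnitsCarrier (w.adicCompletion K)))) (lmapAddHom X₁ X₂ ι x)) =
              0 := fun x => by
        have hx := he x
        rw [lmap_apply] at hx
        rw [lmapAddHom_apply, hx]
        exact hT₀ w hw₀ x
      obtain ⟨e', h1, h2⟩ := exists_unitValued_extension (ρP := (toDGM X₂).restrictField (w.adicCompletion K))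
        (show LCarrier X₂ →ₗ[ℤ] UnitsCarrier (w.adicCompletion K) from
          (e.1 : DiscreteRep.HomCarrier (LCarrier X₂) (UnitsCarrier (w.adicCompletion K)))) (lmapAddHom X₁ X₂ ι)
        hequiv hunit (fun p => exists_int_cast_eq_ordQ_of_isUnramifiedAt w hunr e p)
      refine ⟨e', fun x => ?_, fun _ p => h2 p⟩
      rw [lmap_apply, ← lmapAddHom_apply, h1 x, lmapAddHom_apply, ← lmap_apply]
      exact he x
  choose e he hunit using hcorr
  exact ⟨T₀ ∪ T₁, e, he, hunit⟩

/-! ## §2 The local-to-global extension principle -/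

include h₁ h₂ in
/-- **Extension along `ι` is a local property for `J̄`-valued morphisms.**  Let `ι : X₁ ⟶ X₂` be a morphism of
finite-type objects of `C_Γ` trivialised by a layer `E`, and `g : X₁ ⟶ J̄`.  If at every finite place `w` and every
infinite place `w` the local readout `π_w ∘ g : X₁ → K̄_wˣ` extends along `ι` to a `Γ_{K_w}`-equivariant homomorphism
`X₂ → K̄_wˣ` (an invariant of `Hom_ℤ(X₂|_w, K̄_wˣ)`), then `g = ι ≫ f` for some `f : X₂ ⟶ J̄`.
[cite: MilneADT2006, I Lemma 4.13 (proof), I Theorem 4.10 (proof, p. 58)] [cite: CasselsFrohlichANT1967, Ch. VII §8 Prop. 8.1, §9.7] -/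
theorem exists_comp_eq_of_localExtensions (g : X₁ ⟶ ideleBarD K)
    (hfin : ∀ w : HeightOneSpectrum (𝓞 K),
      ∃ e : (homGaloisModule ((toDGM X₂).restrictField (w.adicCompletion K)) (units (w.adicCompletion K))).toTopRep.ρ.invariants,
        ∀ x : LCarrier X₁, (show LCarrier X₂ →ₗ[ℤ] UnitsCarrier (w.adicCompletion K) from
          (e.1 : DiscreteRep.HomCarrier (LCarrier X₂) (UnitsCarrier (w.adicCompletion K)))) (lmap X₁ X₂ ι x) =
            readoutMap (ideleProjection K (Sum.inr w)) X₁ g x)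
    (hinf : ∀ w : InfinitePlace K,
      ∃ e : (homGaloisModule ((toDGM X₂).restrictField w.Completion) (units w.Completion)).toTopRep.ρ.invariants,
        ∀ x : LCarrier X₁, (show LCarrier X₂ →ₗ[ℤ] UnitsCarrier w.Completion from
          (e.1 : DiscreteRep.HomCarrier (LCarrier X₂) (UnitsCarrier w.Completion))) (lmap X₁ X₂ ι x) =
            readoutMap (ideleProjection K (Sum.inl w)) X₁ g x) :
    ∃ f : X₂ ⟶ ideleBarD K, ι ≫ f = g := by
  classical
  obtain ⟨T, efin, hefin, hunit⟩ := exists_unitValued_localExtensions E ι h₁ h₂ g hfin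
  choose einf heinf using hinf
  -- the family at all places
  let e : ∀ v : Place K,
      (homGaloisModule ((toDGM X₂).restrictField (Place.Completion v)) (units (Place.Completion v))).toTopRep.ρ.invariants :=
    fun v => match v with
      | Sum.inl w => einf w
      | Sum.inr w => efin w
  have he : ∀ (v : Place K) (x : LCarrier X₁),
      (show LCarrier X₂ →ₗ[ℤ] UnitsCarrier (Place.Completion v) from
        ((e v).1 : DiscreteRep.HomCarrier (LCarrier X₂) (UnitsCarrier (Place.Completion v)))) (lmap X₁ X₂ ι x) =
          readoutMap (ideleProjection K v) X₁ g x := by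
    rintro (w | w) x
    · exact heinf w x
    · exact hefin w x
  -- assemble
  obtain ⟨f, hf⟩ := exists_hom_readoutInvariant_eq X₂ E h₂ (T.map ⟨Sum.inr, Sum.inr_injective⟩) e
    (fun w hw p => hunit w (fun h => hw (Finset.mem_map_of_mem _ h)) p)
  refine ⟨f, hom_ext_of_readoutInvariant_eq E h₁ fun v => Subtype.ext (LinearMap.ext fun x => ?_)⟩
  change (show LCarrier X₁ →ₗ[ℤ] UnitsCarrier (Place.Completion v) from
      ((readoutInvariant (ideleProjection K v) X₁ (ι ≫ f)).1 :
        DiscreteRep.HomCarrier (LCarrier X₁) (UnitsCarrier (Place.Completion v)))) x =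
    (show LCarrier X₁ →ₗ[ℤ] UnitsCarrier (Place.Completion v) from
      ((readoutInvariant (ideleProjection K v) X₁ g).1 :
        DiscreteRep.HomCarrier (LCarrier X₁) (UnitsCarrier (Place.Completion v)))) x
  rw [coe_readoutInvariant_comp, precomp_apply_apply, hf v, coe_readoutInvariant]
  exact he v x

include h₁ h₂ in
/-- The same with the local data given at once for all places `v : Place K` (finite and infinite).
[cite: MilneADT2006, I Lemma 4.13 (proof)] -/
theorem exists_comp_eq_of_localExtensions' (g : X₁ ⟶ ideleBarD K)
    (hloc : ∀ v : Place K,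
      ∃ e : (homGaloisModule ((toDGM X₂).restrictField (Place.Completion v)) (units (Place.Completion v))).toTopRep.ρ.invariants,
        ∀ x : LCarrier X₁, (show LCarrier X₂ →ₗ[ℤ] UnitsCarrier (Place.Completion v) from
          (e.1 : DiscreteRep.HomCarrier (LCarrier X₂) (UnitsCarrier (Place.Completion v)))) (lmap X₁ X₂ ι x) =
            readoutMap (ideleProjection K v) X₁ g x) :
    ∃ f : X₂ ⟶ ideleBarD K, ι ≫ f = g :=
  exists_comp_eq_of_localExtensions E ι h₁ h₂ g (fun w => hloc (Sum.inr w)) (fun w => hloc (Sum.inl w))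

/-! ## §3 The principal-idèle case: local extendability of `ι_v ∘ u` forces global extendability of `u ≫ (F̄ˣ → J̄)` -/

include h₁ h₂ in
/-- **Idèle-torus Hasse principle, homomorphism form.**  For `u : X₁ ⟶ F̄ˣ = lim→ Eˣ` (door-c5 g16 `unitsBarD K`):
if at every place `v` the local map `ι_v ∘ u : X₁ → K̄_vˣ` (the transfer of the invariant `unitsInvariant X₁ u` along
`unitsTransfer K K_v`) extends along `ι` to a `Γ_{K_v}`-equivariant `X₂ → K̄_vˣ`, then the principal-idèle-valued
`u ≫ (F̄ˣ → J̄)` extends to a `C_Γ`-morphism `X₂ ⟶ J̄`.  (With `ι` the inclusion of the relation module of a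
permutation cover of a lattice `X`, this says: a class of `Ext¹_{C_Γ}(X, F̄ˣ)` which is locally trivial everywhere dies
in `Ext¹_{C_Γ}(X, J̄)`.) [cite: MilneADT2006, I Theorem 4.10 (proof, p. 58), I Lemma 4.13] -/
theorem exists_comp_eq_unitsToIdele_of_localExtensions (u : X₁ ⟶ unitsBarD K)
    (hloc : ∀ v : Place K,
      ∃ e : (homGaloisModule ((toDGM X₂).restrictField (Place.Completion v)) (units (Place.Completion v))).toTopRep.ρ.invariants,
        precomp ((toDGM X₁).restrictField (Place.Completion v)) ((toDGM X₂).restrictField (Place.Completion v))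
          (units (Place.Completion v)) (restrictIntertwining (toDGM X₁) (toDGM X₂) (lmap X₁ X₂ ι)) e.1 =
        (transferInvariant (toDGM X₁) (units K) (units (Place.Completion v)) (unitsTransfer K (Place.Completion v))
          (unitsInvariant X₁ u)).1) :
    ∃ f : X₂ ⟶ ideleBarD K, ι ≫ f = u ≫ (unitsToIdele K).limitHom := by
  refine exists_comp_eq_of_localExtensions' E ι h₁ h₂ (u ≫ (unitsToIdele K).limitHom) fun v => ?_
  obtain ⟨e, he⟩ := hloc v
  refine ⟨e, fun x => ?_⟩
  have hx := LinearMap.congr_fun (congrArg (fun F : DiscreteRep.HomCarrier (LCarrier X₁) (UnitsCarrier (Place.Completion v)) =>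
    (show LCarrier X₁ →ₗ[ℤ] UnitsCarrier (Place.Completion v) from F)) he) x
  rw [precomp_apply_apply] at hx
  rw [← coe_readoutInvariant, readoutInvariant_comp_unitsToIdele]
  exact hx

end IdeleReadout

end Literature.NumberTheory.GaloisRepresentations

end
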